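import Literature.ModelTheory.ExponentialFields.DefinableFunOn
import HarnessLib

/-!
# The lifting lemma of the o-minimal triangulation theorem (van den Dries 1998, Ch. 8, (2.8))

Proof file (theorems only), the `L`-definable version — `L` an arbitrary expansion of the real
field interpreted on `ℝ` (`IsRealFieldExpansion L`; no o-minimality is needed at this stage) — of
the tree's semialgebraic lifting theorem `exists_lifting`
(`SemialgebraicC1TriangulationLifting.lean`, [Dries1998, Ch. 8 (2.7), (2.8)]): given a finite
definable triangulation `(Φ, K)` of `A ⊆ ℝⁿ` and finitely many continuous definable sections
`G₀, …, G_q` over `A`, comparable on the cells and satisfying condition `(*)`, the band `A^G`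
between the least and the greatest section has a finite definable triangulation lifting `(Φ, K)`,
whose open simplices lie over single open simplices of `K` on a constant side of every section.

The proof is the tree's, verbatim: all its ingredients are either purely convex-geometric /
topological (`exists_simplicialComplex_band`, `band_homeomorph`, `plMap_*`, `plInterpolant_*`,
`sort_apply_eq_of_forall_le_imp`, … — imported from the semialgebraic file) or definability
bookkeeping, now supplied by `DefinableFunOn.lean` (`IsDefinableFunOn.sort_apply`,
`.comp_isDefinableMapOn`, `.of_finset_cover`, `IsDefinableMapOn.definable_sep_mem`, …) in place of
the semialgebraic kit.

## Main statements (all proved)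

* `band_isDefinableMapOn` — the band `{(x, s) : x ∈ A, v₀ x ≤ s ≤ v_q x}` and the band map
  `Ψ_L (x, s) = (Φ x, λ_x(s))` are definable when the data are.
* `exists_lifting_definable` — **the lifting theorem** [Dries1998, Ch. 8 (2.8)], definable version.

## References

* [Dries1998] L. van den Dries, *Tame topology and o-minimal structures* (1998), Ch. 8 (2.7), (2.8)
  (pp. 128–130 of the held copy, read).
-/

noncomputable section

open Set Filter FirstOrder
open _root_.Topology

namespace Literature.ModelTheory.ExponentialFields

universe u v

variable {L : FirstOrder.Language.{u, v}} [L.Structure ℝ]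

/-! ## The band map is definable -/

section Band

/-- **The band homeomorphism is definable.** With definable `A`, `Φ` and nodes `v_k`, `w_k`, the band
`{(x, s) : x ∈ A, v₀ x ≤ s ≤ v_q x}` is definable and the graph of `Ψ_L (x, s) = (Φ x, λ_x(s))` over
it is definable (`λ` the moving-node PL interpolant, a first-order expression in the node values).
[cite: Dries1998, Ch. 8 (2.8)] -/
theorem band_isDefinableMapOn (hL : IsRealFieldExpansion L) {n q : ℕ} {A : Set (Fin n → ℝ)}
    (hA : (univ : Set ℝ).Definable L A)
    {Φ : (Fin n → ℝ) → (Fin n → ℝ)} (hΦ : IsDefinableMapOn L A Φ)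
    {v w : Fin (q + 1) → (Fin n → ℝ) → ℝ} (hv : ∀ k, IsDefinableFunOn L A (v k))
    (hw : ∀ k, IsDefinableFunOn L A (w k))
    {lam : (Fin n → ℝ) → ℝ → ℝ}
    (hlam : ∀ x s, lam x s = w 0 x + ∑ j : Fin q, (w j.succ x - w (Fin.castSucc j) x) *
      max 0 (min 1 ((s - v (Fin.castSucc j) x) / (v j.succ x - v (Fin.castSucc j) x))))
    {AG : Set (Fin (n + 1) → ℝ)}
    (hAG : ∀ z, z ∈ AG ↔ Fin.init z ∈ A ∧ v 0 (Fin.init z) ≤ z (Fin.last n) ∧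
      z (Fin.last n) ≤ v (Fin.last q) (Fin.init z))
    {ΨL : (Fin (n + 1) → ℝ) → (Fin (n + 1) → ℝ)}
    (hΨL : ∀ z, ΨL z = Fin.snoc (Φ (Fin.init z)) (lam (Fin.init z) (z (Fin.last n)))) :
    (univ : Set ℝ).Definable L AG ∧ IsDefinableMapOn L AG ΨL := by
  have hT : (univ : Set ℝ).Definable L {z : Fin (n + 1) → ℝ | Fin.init z ∈ A} := hA.setOf_init_mem
  have hAGs : (univ : Set ℝ).Definable L AG := by
    have h1 := (hv 0).definable_setOf_le_last hL
    have h2 := (hv (Fin.last q)).definable_setOf_last_le hL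
    convert h1.inter h2 using 1
    ext z
    simp only [mem_inter_iff, mem_setOf_eq, hAG]
    tauto
  have hsub : AG ⊆ {z : Fin (n + 1) → ℝ | Fin.init z ∈ A} := fun z hz => ((hAG z).mp hz).1
  refine ⟨hAGs, IsDefinableMapOn.of_forall hAGs fun j => ?_⟩
  refine Fin.lastCases ?_ (fun i => ?_) j
  · -- the fibre coordinate `λ_x(s)`
    have hxv : ∀ k, IsDefinableFunOn L {z : Fin (n + 1) → ℝ | Fin.init z ∈ A}
        (fun z => v k (Fin.init z)) := fun k => (hv k).comp_init
    have hxw : ∀ k, IsDefinableFunOn L {z : Fin (n + 1) → ℝ | Fin.init z ∈ A}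
        (fun z => w k (Fin.init z)) := fun k => (hw k).comp_init
    have hzl : IsDefinableFunOn L {z : Fin (n + 1) → ℝ | Fin.init z ∈ A}
        (fun z => z (Fin.last n)) := isDefinableFunOn_apply hT (Fin.last n)
    have hstep : ∀ j' : Fin q, IsDefinableFunOn L {z : Fin (n + 1) → ℝ | Fin.init z ∈ A}
        (fun z => (w j'.succ (Fin.init z) - w (Fin.castSucc j') (Fin.init z)) *
          max 0 (min 1 ((z (Fin.last n) - v (Fin.castSucc j') (Fin.init z)) /
            (v j'.succ (Fin.init z) - v (Fin.castSucc j') (Fin.init z))))) := by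
      intro j'
      refine IsDefinableFunOn.mul hL (IsDefinableFunOn.sub hL (hxw _) (hxw _)) ?_
      refine IsDefinableFunOn.max hL (isDefinableFunOn_const hT 0) ?_
      refine IsDefinableFunOn.min hL (isDefinableFunOn_const hT 1) ?_
      exact IsDefinableFunOn.div₀ hL (IsDefinableFunOn.sub hL hzl (hxv _))
        (IsDefinableFunOn.sub hL (hxv _) (hxv _))
    have htot := IsDefinableFunOn.add hL (hxw 0)
      (IsDefinableFunOn.finset_sum hL hT Finset.univ fun j' _ => hstep j')
    refine (htot.mono hsub hAGs).congr fun z _ => ?_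
    simp only [hΨL, Fin.snoc_last, hlam]
  · have hΦi : IsDefinableFunOn L A (fun x => Φ x i) := hΦ.apply hA i
    refine ((hΦi.comp_init).mono hsub hAGs).congr fun z _ => ?_
    simp only [hΨL, Fin.snoc_castSucc]

end Band

/-! ## The lifting theorem -/

section Lifting

open Literature.Analysis.Convexity

/-- **The lifting theorem** [cite: Dries1998, Ch. 8 (2.8)], `L`-definable version with global
sections (`L` any expansion of the real field).  Let `(Φ, K)` be a finite definable triangulation of
`A ⊆ ℝⁿ` with inverse `Ψ`, and `G₀, …, G_q` continuous functions definable on `A` which on every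
cell `Ψ(Int τ)`, `τ ∈ K`, are pairwise comparable (`<`, `=` or `>` throughout) and satisfy
condition `(*)`: two of them agreeing at the vertices `Ψ(v)`, `v ∈ τ`, agree on the cell.  Then the
band `A^G = {(x, t) : x ∈ A, minᵢ Gᵢ x ≤ t ≤ maxᵢ Gᵢ x}` has a finite definable triangulation
`(Φ_L, L)` lifting `(Φ, K)` (`init ∘ Φ_L = Φ ∘ init`), whose open simplices lie over single open
simplices of `K` and are carried by `Ψ_L = Φ_L⁻¹` to a constant side of every section. The proof
is the tree's semialgebraic `exists_lifting` with the definability kit of `DefinableFunOn.lean`. -/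
theorem exists_lifting_definable (hL : IsRealFieldExpansion L) {n q : ℕ} {A : Set (Fin n → ℝ)}
    {K : Geometry.SimplicialComplex ℝ (Fin n → ℝ)} (hK : K.faces.Finite)
    {Φ Ψ : (Fin n → ℝ) → (Fin n → ℝ)} (hΦ : IsDefinableHomeomorphOn L A K.space Φ Ψ)
    {G : Fin (q + 1) → (Fin n → ℝ) → ℝ} (hGc : ∀ i, ContinuousOn (G i) A)
    (hGs : ∀ i, IsDefinableFunOn L A (G i))
    (hcomp : ∀ τ ∈ K.faces, ∀ i j, (∀ p ∈ openSimplex ℝ τ, G i (Ψ p) < G j (Ψ p)) ∨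
      (∀ p ∈ openSimplex ℝ τ, G i (Ψ p) = G j (Ψ p)) ∨
        (∀ p ∈ openSimplex ℝ τ, G j (Ψ p) < G i (Ψ p)))
    (hstar : ∀ τ ∈ K.faces, ∀ i j, (∀ v ∈ τ, G i (Ψ v) = G j (Ψ v)) →
      ∀ p ∈ openSimplex ℝ τ, G i (Ψ p) = G j (Ψ p)) :
    ∃ (Lc : Geometry.SimplicialComplex ℝ (Fin (n + 1) → ℝ))
      (ΦL ΨL : (Fin (n + 1) → ℝ) → (Fin (n + 1) → ℝ)), Lc.faces.Finite ∧
      IsDefinableHomeomorphOn L {z | (Fin.init z : Fin n → ℝ) ∈ A ∧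
        (∃ i, G i (Fin.init z) ≤ z (Fin.last n)) ∧ ∃ i, z (Fin.last n) ≤ G i (Fin.init z)}
        Lc.space ΦL ΨL ∧
      (∀ z, Fin.init (ΦL z) = Φ (Fin.init z)) ∧ (∀ z, Fin.init (ΨL z) = Ψ (Fin.init z)) ∧
      ∀ σ ∈ Lc.faces, ∃ τ ∈ K.faces, ∃ ε : Fin (q + 1) → SignType, ∀ z ∈ openSimplex ℝ σ,
        (Fin.init z : Fin n → ℝ) ∈ openSimplex ℝ τ ∧
          ∀ i, SignType.sign (ΨL z (Fin.last n) - G i (Ψ (Fin.init z))) = ε i := by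
  classical
  have hA : (univ : Set ℝ).Definable L A := hΦ.definable_left
  -- the heights
  set ℓ : Fin (q + 1) → (Fin n → ℝ) → ℝ := fun i => plMap K (G i ∘ Ψ) with hℓ_def
  have hGΨc : ∀ i, ContinuousOn (G i ∘ Ψ) K.space := fun i =>
    (hGc i).comp hΦ.continuousOn_symm hΦ.mapsTo_symm
  have hℓaff : ∀ i, ∀ τ ∈ K.faces, ∃ A' : (Fin n → ℝ) →ᵃ[ℝ] ℝ,
      EqOn (ℓ i) A' (convexHull ℝ (τ : Set (Fin n → ℝ))) := fun i τ hτ => by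
    obtain ⟨A', hA', -⟩ := exists_affineMap_eqOn_plMap (K := K) (g := G i ∘ Ψ) hτ
    exact ⟨A', hA'⟩
  have hℓc : ∀ i, ContinuousOn (ℓ i) K.space := fun i => continuousOn_plMap hK _
  -- order relations between heights and sections on open simplices
  have hlt_imp : ∀ τ ∈ K.faces, ∀ p ∈ openSimplex ℝ τ, ∀ i j,
      G i (Ψ p) < G j (Ψ p) → ℓ i p < ℓ j p := by
    intro τ hτ p hp i j hij
    have hlt : ∀ p' ∈ openSimplex ℝ τ, (G i ∘ Ψ) p' < (G j ∘ Ψ) p' := by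
      rcases hcomp τ hτ i j with h | h | h
      · exact h
      · exact absurd (h p hp) hij.ne
      · exact (lt_asymm hij (h p hp)).elim
    exact plMap_lt_plMap_on_openSimplex hτ ((hGΨc i).mono (K.convexHull_subset_space hτ))
      ((hGΨc j).mono (K.convexHull_subset_space hτ)) hlt (fun hv p' hp' => hstar τ hτ i j hv p' hp')
      p hp
  have heq_imp : ∀ τ ∈ K.faces, ∀ p ∈ openSimplex ℝ τ, ∀ i j,
      G i (Ψ p) = G j (Ψ p) → ℓ i p = ℓ j p := by
    intro τ hτ p hp i j hij
    have heq : EqOn (G i ∘ Ψ) (G j ∘ Ψ) (openSimplex ℝ τ) := by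
      rcases hcomp τ hτ i j with h | h | h
      · exact absurd hij (h p hp).ne
      · exact fun p' hp' => h p' hp'
      · exact absurd hij (h p hp).ne'
    exact plMap_eqOn_of_eqOn_openSimplex hτ ((hGΨc i).mono (K.convexHull_subset_space hτ))
      ((hGΨc j).mono (K.convexHull_subset_space hτ)) heq
      (openSimplex_subset_convexHull (𝕜 := ℝ) _ hp)
  have hle_imp : ∀ τ ∈ K.faces, ∀ p ∈ openSimplex ℝ τ, ∀ i j,
      G i (Ψ p) ≤ G j (Ψ p) → ℓ i p ≤ ℓ j p := fun τ hτ p hp i j h =>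
    h.lt_or_eq.elim (fun h' => (hlt_imp τ hτ p hp i j h').le)
      fun h' => (heq_imp τ hτ p hp i j h').le
  -- the nodes: order statistics of the sections and of the heights
  set v : Fin (q + 1) → (Fin n → ℝ) → ℝ :=
    fun k x => (fun i => G i x) (Tuple.sort (fun i => G i x) k) with hv_def
  set w : Fin (q + 1) → (Fin n → ℝ) → ℝ :=
    fun k x => (fun i => ℓ i (Φ x)) (Tuple.sort (fun i => ℓ i (Φ x)) k) with hw_def
  have hpair : ∀ x ∈ A, ∀ k, w k x = ℓ (Tuple.sort (fun i => G i x) k) (Φ x) := by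
    intro x hx k
    obtain ⟨τ, hτ, hp⟩ := exists_mem_openSimplex_of_mem_space (hΦ.mapsTo hx)
    have hx' : Ψ (Φ x) = x := hΦ.left_inv hx
    have key := sort_apply_eq_of_forall_le_imp (a := fun i => G i x) (b := fun i => ℓ i (Φ x))
      (fun i j hij => by
        have h := hle_imp τ hτ (Φ x) hp i j
        rw [hx'] at h
        exact h hij) k
    exact key
  have hvm : ∀ x ∈ A, Monotone fun k => v k x := fun x _ =>
    Tuple.monotone_sort (fun i => G i x)
  have hwm : ∀ x ∈ A, Monotone fun k => w k x := fun x _ =>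
    Tuple.monotone_sort (fun i => ℓ i (Φ x))
  have htie : ∀ x ∈ A, ∀ j : Fin q,
      v (Fin.castSucc j) x = v j.succ x ↔ w (Fin.castSucc j) x = w j.succ x := by
    intro x hx j
    obtain ⟨τ, hτ, hp⟩ := exists_mem_openSimplex_of_mem_space (hΦ.mapsTo hx)
    have hx' : Ψ (Φ x) = x := hΦ.left_inv hx
    rw [hpair x hx, hpair x hx]
    constructor
    · intro h
      have h' := heq_imp τ hτ (Φ x) hp (Tuple.sort (fun i => G i x) (Fin.castSucc j))
        (Tuple.sort (fun i => G i x) j.succ)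
      rw [hx'] at h'
      exact h' h
    · intro h
      by_contra hne
      have hlt : G (Tuple.sort (fun i => G i x) (Fin.castSucc j)) x <
          G (Tuple.sort (fun i => G i x) j.succ) x :=
        lt_of_le_of_ne (Tuple.monotone_sort (fun i => G i x) (Fin.castSucc_lt_succ (i := j)).le) hne
      have h' := hlt_imp τ hτ (Φ x) hp (Tuple.sort (fun i => G i x) (Fin.castSucc j))
        (Tuple.sort (fun i => G i x) j.succ)
      rw [hx'] at h'
      exact (h' hlt).ne h
  -- continuity and definability of the nodes
  have hvc : ∀ k, ContinuousOn (v k) A := by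
    intro k
    rw [continuousOn_iff_continuous_restrict]
    exact continuous_sort_apply (X := A) (g := fun i (x : A) => G i x)
      (fun i => continuousOn_iff_continuous_restrict.mp (hGc i)) k
  have hℓΦc : ∀ i, ContinuousOn (fun x => ℓ i (Φ x)) A := fun i =>
    (hℓc i).comp hΦ.continuousOn hΦ.mapsTo
  have hwc : ∀ k, ContinuousOn (w k) A := by
    intro k
    rw [continuousOn_iff_continuous_restrict]
    exact continuous_sort_apply (X := A) (g := fun i (x : A) => ℓ i (Φ x))
      (fun i => continuousOn_iff_continuous_restrict.mp (hℓΦc i)) k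
  have hvs : ∀ k, IsDefinableFunOn L A (v k) := fun k =>
    IsDefinableFunOn.sort_apply hL hA hGs k
  have hℓΦs : ∀ i, IsDefinableFunOn L A (fun x => ℓ i (Φ x)) := by
    intro i
    choose Aff hAff using hℓaff i
    refine IsDefinableFunOn.of_finset_cover hK.toFinset
      (fun τ => {x | x ∈ A ∧ Φ x ∈ convexHull ℝ (τ : Set (Fin n → ℝ))}) ?_ ?_
    · ext x
      simp only [mem_iUnion, mem_setOf_eq, Set.Finite.mem_toFinset, exists_prop]
      constructor
      · intro hx
        obtain ⟨τ, hτ, hxτ⟩ := Geometry.SimplicialComplex.mem_space_iff.1 (hΦ.mapsTo hx)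
        exact ⟨τ, hτ, hx, hxτ⟩
      · rintro ⟨τ, -, hx, -⟩
        exact hx
    · intro τ hτ'
      have hτ : τ ∈ K.faces := hK.mem_toFinset.mp hτ'
      have hpiece : (univ : Set ℝ).Definable L
          {x | x ∈ A ∧ Φ x ∈ convexHull ℝ (τ : Set (Fin n → ℝ))} :=
        hΦ.isDefinableMapOn.definable_sep_mem (hL.definable_convexHull_finset τ)
      have hΦ' : IsDefinableMapOn L {x | x ∈ A ∧ Φ x ∈ convexHull ℝ (τ : Set (Fin n → ℝ))} Φ :=
        hΦ.isDefinableMapOn.mono (fun x hx => hx.1) hpiece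
      have hco := IsDefinableFunOn.comp_isDefinableMapOn
        (AffineMap.isDefinableFunOn hL (Aff τ hτ) Set.definable_univ) hΦ' (mapsTo_univ _ _)
      exact hco.congr fun x hx => (hAff τ hτ hx.2).symm
  have hws : ∀ k, IsDefinableFunOn L A (w k) := fun k =>
    IsDefinableFunOn.sort_apply hL hA hℓΦs k
  -- the fibre maps, the band maps and the band
  set lam : (Fin n → ℝ) → ℝ → ℝ := fun x s => w 0 x + ∑ j : Fin q,
    (w j.succ x - w (Fin.castSucc j) x) *
      max 0 (min 1 ((s - v (Fin.castSucc j) x) / (v j.succ x - v (Fin.castSucc j) x))) with hlam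
  set mu : (Fin n → ℝ) → ℝ → ℝ := fun x t => v 0 x + ∑ j : Fin q,
    (v j.succ x - v (Fin.castSucc j) x) *
      max 0 (min 1 ((t - w (Fin.castSucc j) x) / (w j.succ x - w (Fin.castSucc j) x))) with hmu
  set ΦL : (Fin (n + 1) → ℝ) → (Fin (n + 1) → ℝ) :=
    fun z => Fin.snoc (Φ (Fin.init z)) (lam (Fin.init z) (z (Fin.last n))) with hΦL
  set ΨL : (Fin (n + 1) → ℝ) → (Fin (n + 1) → ℝ) :=
    fun z => Fin.snoc (Ψ (Fin.init z)) (mu (Ψ (Fin.init z)) (z (Fin.last n))) with hΨL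
  set AG : Set (Fin (n + 1) → ℝ) := {z | (Fin.init z : Fin n → ℝ) ∈ A ∧
    (∃ i, G i (Fin.init z) ≤ z (Fin.last n)) ∧ ∃ i, z (Fin.last n) ≤ G i (Fin.init z)} with hAG
  obtain ⟨Lc, hLcfin, hLcspace, hLccomp⟩ := exists_simplicialComplex_band K hK ℓ hℓaff
  have hAG' : ∀ z, z ∈ AG ↔ Fin.init z ∈ A ∧ v 0 (Fin.init z) ≤ z (Fin.last n) ∧
      z (Fin.last n) ≤ v (Fin.last q) (Fin.init z) := by
    intro z
    simp only [hAG, mem_setOf_eq, hv_def]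
    rw [exists_apply_le_iff_sort_zero (fun i => G i (Fin.init z)),
      exists_le_apply_iff_sort_last (fun i => G i (Fin.init z))]
  have hΛ' : ∀ z, z ∈ Lc.space ↔ Fin.init z ∈ K.space ∧ w 0 (Ψ (Fin.init z)) ≤ z (Fin.last n) ∧
      z (Fin.last n) ≤ w (Fin.last q) (Ψ (Fin.init z)) := by
    intro z
    rw [hLcspace]
    simp only [mem_setOf_eq]
    constructor
    · rintro ⟨hzK, h1, h2⟩
      have hp : Φ (Ψ (Fin.init z)) = Fin.init z := hΦ.right_inv hzK
      simp only [hw_def, hp]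
      exact ⟨hzK, (exists_apply_le_iff_sort_zero _ _).mp h1,
        (exists_le_apply_iff_sort_last _ _).mp h2⟩
    · rintro ⟨hzK, h1, h2⟩
      have hp : Φ (Ψ (Fin.init z)) = Fin.init z := hΦ.right_inv hzK
      simp only [hw_def, hp] at h1 h2
      exact ⟨hzK, (exists_apply_le_iff_sort_zero _ _).mpr h1,
        (exists_le_apply_iff_sort_last _ _).mpr h2⟩
  obtain ⟨hmaps, hmaps', hlinv, hrinv, hcΦL, hcΨL⟩ := band_homeomorph hΦ.mapsTo hΦ.mapsTo_symm
    (fun x hx => hΦ.left_inv hx) (fun p hp => hΦ.right_inv hp) hΦ.continuousOn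
    hΦ.continuousOn_symm hvc hwc hvm hwm htie (lam := lam) (mu := mu) (fun _ _ => rfl)
    (fun _ _ => rfl) hAG' hΛ' (ΨL := ΦL) (ΦL := ΨL) (fun _ => rfl) (fun _ => rfl)
  obtain ⟨-, hsa⟩ := band_isDefinableMapOn hL hA hΦ.isDefinableMapOn hvs hws (lam := lam)
    (fun _ _ => rfl) hAG' (ΨL := ΦL) (fun _ => rfl)
  refine ⟨Lc, ΦL, ΨL, hLcfin, ⟨hmaps, hmaps', hlinv, hrinv, hcΦL, hcΨL, hsa⟩,
    fun z => by simp [hΦL], fun z => by simp [hΨL], ?_⟩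
  -- compatibility
  intro σ hσ
  obtain ⟨τ, hτ, ε, hε⟩ := hLccomp σ hσ
  refine ⟨τ, hτ, ε, fun z hz => ?_⟩
  obtain ⟨hzτ, hsign⟩ := hε z hz
  refine ⟨hzτ, fun i => ?_⟩
  have hpK : Fin.init z ∈ K.space := openSimplex_subset_space hτ hzτ
  have hxA : Ψ (Fin.init z) ∈ A := hΦ.mapsTo_symm hpK
  have hΦΨ : Φ (Ψ (Fin.init z)) = Fin.init z := hΦ.right_inv hpK
  have hzΛ : z ∈ Lc.space :=
    Geometry.SimplicialComplex.convexHull_subset_space hσ (openSimplex_subset_convexHull (𝕜 := ℝ) _ hz)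
  obtain ⟨-, ht1, ht2⟩ := (hΛ' z).mp hzΛ
  -- the rank `k` of the section `i` at `Ψ (init z)`
  set k := (Tuple.sort fun i => G i (Ψ (Fin.init z))).symm i with hk
  have hki : (Tuple.sort fun i => G i (Ψ (Fin.init z))) k = i := Equiv.apply_symm_apply _ _
  have hvk : v k (Ψ (Fin.init z)) = G i (Ψ (Fin.init z)) := by
    simp only [hv_def]
    rw [hki]
  have hwk : w k (Ψ (Fin.init z)) = ℓ i (Fin.init z) := by
    rw [hpair _ hxA, hki, hΦΨ]
  have hlast : ΨL z (Fin.last n) = mu (Ψ (Fin.init z)) (z (Fin.last n)) := by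
    simp [hΨL]
  rw [hlast, ← hvk, ← hsign i, ← hwk]
  let v' : Fin (q + 1) → A → ℝ := fun k x => v k x
  let w' : Fin (q + 1) → A → ℝ := fun k x => w k x
  exact plInterpolant_sign (v := w') (w := v') (fun x => hwm x x.2) (fun x => hvm x x.2)
    (fun j x => (htie x x.2 j).mpr) (fun j x => (htie x x.2 j).mp) ⟨Ψ (Fin.init z), hxA⟩
    ⟨ht1, ht2⟩ k

end Lifting

end Literature.ModelTheory.ExponentialFields
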